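import Mathlib
import HarnessLib
import Literature.Analysis.FluidPDE.ClassicalSolution
import Literature.Analysis.FluidPDE.Vorticity
import Summits.NavierStokesRegularity.NavierStokesRegularity.Theorems.QuarterLogPincerBeadCensusDefs
import Summits.NavierStokesRegularity.NavierStokesRegularity.Theorems.QuarterLogPincerBeadCensusKernel
import Summits.NavierStokesRegularity.NavierStokesRegularity.Theorems.QuarterLogPincerCubicRungDefs
import Summits.NavierStokesRegularity.NavierStokesRegularity.Theorems.QuarterLogPincerThinCascadeDefs
import Summits.NavierStokesRegularity.NavierStokesRegularity.Theorems.QuarterLogPincerTypeIQuantSubcubicExpStubUniformScaledEnergy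
import Summits.NavierStokesRegularity.NavierStokesRegularity.Theorems.QuarterLogPincerTypeIQuantSubcubicExpFrameTools
import Summits.NavierStokesRegularity.NavierStokesRegularity.Theorems.QuarterLogPincerTypeIQuantSubcubicExpZoomEnergyA
import Summits.NavierStokesRegularity.NavierStokesRegularity.Theorems.QuarterLogPincerTypeIQuantSubcubicExpRescaleTools
import Summits.NavierStokesRegularity.NavierStokesRegularity.Theorems.QuarterLogPincerTypeIQuantSubcubicExpUnitScaleTools
import Summits.NavierStokesRegularity.NavierStokesRegularity.Theorems.QuarterLogPincerHelmholtzCentreDefs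
import Summits.NavierStokesRegularity.NavierStokesRegularity.Theorems.QuarterLogPincerHelmholtzCentreShellKernel
import Summits.NavierStokesRegularity.NavierStokesRegularity.Theorems.QuarterLogPincerFlatChainDefs
import Summits.NavierStokesRegularity.NavierStokesRegularity.Theorems.QuarterLogPincerFlatChainTypeIEpoch
import Literature.Analysis.FluidPDE.BarkerPrangeLocalizedSmoothingBounds
import Literature.Analysis.FluidPDE.BarkerPrangeConcentrationProofs
import Literature.Analysis.FluidPDE.BackwardHeatPointwise
import Literature.Analysis.FluidPDE.AncientWeakL3BackwardLiouvilleAssembly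
import Literature.Analysis.FluidPDE.LocalEnergySolutionsOn
import Literature.Analysis.FluidPDE.LocalLerayExistence
import Literature.Analysis.FluidPDE.BoundedMildWeakL3LocalEnergySolution
import Literature.Analysis.FluidPDE.BoundedMildWeakL3RieszPressure
import Literature.Analysis.FluidPDE.KatoLocalLerayPressureProofs
import Literature.Analysis.FluidPDE.VeryWeakToDistributional
import Literature.Analysis.FluidPDE.VeryWeakToDistributionalFour
import Literature.Analysis.FluidPDE.ClassicalBoundedWeak
import Literature.Analysis.FluidPDE.MildSolution
import Literature.Analysis.SingularIntegrals.HardyLittlewoodSobolev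
import Literature.Analysis.FluidPDE.VorticityCalculus
import Literature.Analysis.FluidPDE.BiotSavartWeakLp
import Summits.NavierStokesRegularity.NavierStokesRegularity.Theorems.QuarterLogPincerFlatChainSliceDefs
import Literature.Analysis.FluidPDE.UlocKernelEstimates

/-!
# Route `QuarterLogPincer`, crux `TypeIQuantSubcubicExp` (stmt-NavierStokesRegularity-24077), line `flat_chain` —
# Q3 `quietSliceSmallCube_holds : QuietSliceSmallCube` (+ `stub_quietSliceSmallCube`), the author's §9a proof VERBATIM

Q3: for a `C²` divergence-free field, quiet vorticity on `B(x₀,2R)` ⇒ small cube mass on `B(x₀,2r)` — H2♭ `HelmholtzCentre.stub_shellKernelBound`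
(PROVED, typer g38) + the tree's STRONG Hardy–Littlewood–Sobolev inequality (`lintegral_rieszPotential_rpow_le`, `α = 1`, `p = 2`) +
Cauchy–Schwarz on the ball.  Over the objects home `…FlatChainSliceDefs`.
HONEST FRAME: ports of the author's kernel-checked in-file proofs about HYPOTHETICAL Type-I classical solutions; no census node,
⟨24077⟩, W7 or Navier–Stokes regularity is proved (OPEN).  pub-ns-dss typer (g39), `--supports stmt-NavierStokesRegularity-24077`;
texts by ns-idea-7 (g14), workfile `Cruxes/TypeIQuantSubcubicExp/Lines/flat_chain.lean` v1.12 (sha f4adcfe506ba), VERBATIM.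
-/

set_option linter.dupNamespace false

namespace Summit.NavierStokesRegularity.NavierStokesRegularity.Cruxes.TypeIQuantSubcubicExp.FlatChain

noncomputable section

open MeasureTheory Set Metric
open scoped ENNReal NNReal Classical
open Literature.Analysis Literature.Analysis.FluidPDE
open Summit.NavierStokesRegularity.NavierStokesRegularity.Cruxes.TypeIQuantSubcubicExp.BeadCensus
open Summit.NavierStokesRegularity.NavierStokesRegularity.Cruxes.TypeIQuantSubcubicExp.CubicRung

/-! ### §9a (v1.3) **Q3 PROVED**: `quietSliceSmallCube_holds` — H2♭ (PROVED) + the tree's STRONG HLS inequality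
`lintegral_rieszPotential_rpow_le` (`α = 1`, `p = 2 ↦ L⁶`, PROVED, `Literature/Analysis/SingularIntegrals/HardyLittlewoodSobolev`)
+ Cauchy–Schwarz on the ball (no layer cake needed).  Constant: `C = 4(a⁶c_S)^{1/2}(8|B₁|)^{1/2} + 128 C_H³|B₁| + 1`,
`a = (4π)⁻¹`. -/

open Literature.Analysis.SingularIntegrals


/-- The tree's Hardy–Littlewood–Sobolev inequality (`lintegral_rieszPotential_rpow_le`, PROVED) on `ℝ³` at
`α = 1`, `p = 2`: `∫ (I₁Φ)⁶ ≤ C (∫ Φ²)³`. -/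
theorem hls_one_two_six :
    ∃ C : ℝ≥0∞, C < ∞ ∧ ∀ Φ : EuclideanSpace ℝ (Fin 3) → ℝ≥0∞, AEMeasurable Φ volume →
      ∫⁻ x, rieszPotential volume 1 Φ x ^ (6 : ℝ) ≤ C * (∫⁻ y, Φ y ^ (2 : ℝ)) ^ (3 : ℝ) := by
  obtain ⟨C, hC, H⟩ := lintegral_rieszPotential_rpow_le
    (volume : Measure (EuclideanSpace ℝ (Fin 3))) (α := 1) (p := 2) (by norm_num) (by norm_num)
    (by rw [finrank_real_euclideanSpace_fin_three]; norm_num)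
  refine ⟨C, hC, fun Φ hΦ => ?_⟩
  have h := H Φ hΦ
  have e1 : (Module.finrank ℝ (EuclideanSpace ℝ (Fin 3)) : ℝ) * 2 /
      ((Module.finrank ℝ (EuclideanSpace ℝ (Fin 3)) : ℝ) - 1 * 2) = 6 := by
    rw [finrank_real_euclideanSpace_fin_three]; norm_num
  have e2 : (Module.finrank ℝ (EuclideanSpace ℝ (Fin 3)) : ℝ) /
      ((Module.finrank ℝ (EuclideanSpace ℝ (Fin 3)) : ℝ) - 1 * 2) = 3 := by
    rw [finrank_real_euclideanSpace_fin_three]; norm_num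
  rw [e1, e2] at h
  exact h

/-- Cauchy–Schwarz on a set: `∫_s g³ ≤ (∫_s g⁶)^{1/2} · |s|^{1/2}`. -/
theorem setLIntegral_rpow_three_le {g : EuclideanSpace ℝ (Fin 3) → ℝ≥0∞} (hg : Measurable g)
    (s : Set (EuclideanSpace ℝ (Fin 3))) :
    ∫⁻ x in s, g x ^ (3 : ℝ) ≤ (∫⁻ x in s, g x ^ (6 : ℝ)) ^ (1 / 2 : ℝ) * volume s ^ (1 / 2 : ℝ) := by
  have h := ENNReal.lintegral_mul_le_Lp_mul_Lq (volume.restrict s) Real.HolderConjugate.two_two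
    (f := fun x => g x ^ (3 : ℝ)) (g := fun _ => (1 : ℝ≥0∞))
    ((hg.pow_const _).aemeasurable) aemeasurable_const
  have e1 : ∀ x, (g x ^ (3 : ℝ)) ^ (2 : ℝ) = g x ^ (6 : ℝ) := fun x => by
    rw [← ENNReal.rpow_mul]; norm_num
  simp only [Pi.mul_apply, mul_one, e1, ENNReal.one_rpow, lintegral_const, Measure.restrict_apply_univ,
    one_mul] at h
  exact h

/-- `(A·x³)^{1/2} = A^{1/2} x^{3/2}` for `A, x ≥ 0`. -/
theorem mul_rpow_three_sqrt {A x : ℝ} (hA : 0 ≤ A) (hx : 0 ≤ x) :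
    (A * x ^ (3 : ℝ)) ^ (1 / 2 : ℝ) = A ^ (1 / 2 : ℝ) * x ^ (3 / 2 : ℝ) := by
  rw [Real.mul_rpow hA (Real.rpow_nonneg hx _), ← Real.rpow_mul hx]; norm_num

/-- **Q3 `QuietSliceSmallCube` PROVED** (v1.3) from the PROVED H2♭ `HelmholtzCentre.stub_shellKernelBound`, the tree's
pointwise bound `‖K₃∗ω‖ ≤ (4π)⁻¹ I₁|ω|` (`enorm_biotSavart_le_rieszPotential`), the tree's strong HLS inequality
(`lintegral_rieszPotential_rpow_le`, `p = 2 ↦ L⁶`) and Cauchy–Schwarz on the ball. -/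
theorem quietSliceSmallCube_holds : QuietSliceSmallCube := by
  obtain ⟨CH, hCH1, HH⟩ := HelmholtzCentre.stub_shellKernelBound
  obtain ⟨CS, hCS, HS⟩ := hls_one_two_six
  have hCH0 : 0 ≤ CH := by linarith
  obtain ⟨v1, hv1, hV1eq⟩ : ∃ v1 : ℝ, 0 ≤ v1 ∧
      volume (ball (0 : EuclideanSpace ℝ (Fin 3)) 1) = ENNReal.ofReal v1 :=
    ⟨_, ENNReal.toReal_nonneg, (ENNReal.ofReal_toReal measure_ball_lt_top.ne).symm⟩
  obtain ⟨cS, hcS, hCSeq⟩ : ∃ c : ℝ, 0 ≤ c ∧ CS = ENNReal.ofReal c :=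
    ⟨_, ENNReal.toReal_nonneg, (ENNReal.ofReal_toReal hCS.ne).symm⟩
  obtain ⟨a, ha_def⟩ : ∃ a : ℝ, a = (4 * Real.pi)⁻¹ := ⟨_, rfl⟩
  have ha : 0 ≤ a := by rw [ha_def]; positivity
  obtain ⟨K₁, hK₁⟩ : ∃ K : ℝ, K = 4 * (a ^ (6 : ℝ) * cS) ^ (1 / 2 : ℝ) * (8 * v1) ^ (1 / 2 : ℝ) := ⟨_, rfl⟩
  obtain ⟨K₂, hK₂⟩ : ∃ K : ℝ, K = 128 * CH ^ 3 * v1 := ⟨_, rfl⟩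
  have hK₁0 : 0 ≤ K₁ := by rw [hK₁]; positivity
  have hK₂0 : 0 ≤ K₂ := by rw [hK₂]; positivity
  refine ⟨K₁ + K₂ + 1, by positivity, fun v hv hdiv x₀ r R hr hrR => ?_⟩
  have hR : 0 < R := by linarith
  -- the three real quantities of the statement
  set X : ℝ := ∫ x in ball x₀ (2 * R), ‖curl v x‖ ^ 2 with hX
  set Y : ℝ := (R ^ 3)⁻¹ * ∫ x in ball x₀ (2 * R), ‖v x‖ with hY
  set Z : ℝ := (R ^ 2)⁻¹ * ∫ x in ball x₀ (2 * R), ‖curl v x‖ with hZ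
  have hX0 : 0 ≤ X := integral_nonneg fun _ => by positivity
  have hY0 : 0 ≤ Y := mul_nonneg (by positivity) (integral_nonneg fun _ => norm_nonneg _)
  have hZ0 : 0 ≤ Z := mul_nonneg (by positivity) (integral_nonneg fun _ => norm_nonneg _)
  obtain ⟨H, hH⟩ : ∃ H : ℝ, H = CH * (Y + Z) := ⟨_, rfl⟩
  have hH0 : 0 ≤ H := by rw [hH]; positivity
  -- continuity / integrability on the big ball
  have hvc : Continuous v := hv.continuous
  have hωc : Continuous (curl v) := continuous_curl (hv.of_le (by norm_num))
  have hint_v : IntegrableOn (fun x => ‖v x‖) (ball x₀ (2 * R)) volume :=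
    (hvc.norm.continuousOn.integrableOn_compact (isCompact_closedBall x₀ (2 * R))).mono_set
      ball_subset_closedBall
  have hint_ω : IntegrableOn (fun x => ‖curl v x‖) (ball x₀ (2 * R)) volume :=
    (hωc.norm.continuousOn.integrableOn_compact (isCompact_closedBall x₀ (2 * R))).mono_set
      ball_subset_closedBall
  have hint_ω2 : IntegrableOn (fun x => ‖curl v x‖ ^ 2) (ball x₀ (2 * R)) volume :=
    ((hωc.norm.pow 2).continuousOn.integrableOn_compact (isCompact_closedBall x₀ (2 * R))).mono_set
      ball_subset_closedBall
  -- the size `Φ = |curl v|·1_{B(x₀,2R)}` and the majorant `G = (4π)⁻¹ I₁Φ`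
  set Φ : EuclideanSpace ℝ (Fin 3) → ℝ≥0∞ := (ball x₀ (2 * R)).indicator fun z => ‖curl v z‖ₑ with hΦ
  have hΦm : Measurable Φ := (hωc.measurable.enorm).indicator measurableSet_ball
  set G : EuclideanSpace ℝ (Fin 3) → ℝ≥0∞ := fun y => ENNReal.ofReal a * rieszPotential volume 1 Φ y
    with hG
  have hGm : Measurable G := (measurable_rieszPotential volume 1 hΦm).const_mul _
  -- Step A: pointwise majorant on the small ball
  have hA : ∀ y ∈ ball x₀ (2 * r), ‖v y‖ₑ ≤ G y + ENNReal.ofReal H := by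
    intro y hy
    have hsub : ball y R ⊆ ball x₀ (2 * R) := by
      intro z hz
      rw [mem_ball] at hz hy ⊢
      calc dist z x₀ ≤ dist z y + dist y x₀ := dist_triangle _ _ _
        _ < R + 2 * r := add_lt_add hz hy
        _ ≤ 2 * R := by linarith
    have h1 := HH v hv hdiv y R hR
    have h2 : ∫ x in ball y R, ‖v x‖ ≤ ∫ x in ball x₀ (2 * R), ‖v x‖ :=
      setIntegral_mono_set hint_v (Filter.Eventually.of_forall fun _ => norm_nonneg _)
        (Filter.Eventually.of_forall fun z (hz : z ∈ ball y R) => hsub hz)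
    have h3 : ∫ x in ball y R, ‖curl v x‖ ≤ ∫ x in ball x₀ (2 * R), ‖curl v x‖ :=
      setIntegral_mono_set hint_ω (Filter.Eventually.of_forall fun _ => norm_nonneg _)
        (Filter.Eventually.of_forall fun z (hz : z ∈ ball y R) => hsub hz)
    have h4 : ‖v y - biotSavart (HelmholtzCentre.cutVorticity v y R) y‖ ≤ H := by
      calc ‖v y - biotSavart (HelmholtzCentre.cutVorticity v y R) y‖
          ≤ CH * ((R ^ 3)⁻¹ * (∫ x in ball y R, ‖v x‖) + (R ^ 2)⁻¹ * (∫ x in ball y R, ‖curl v x‖)) := h1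
        _ ≤ CH * (Y + Z) := by
          apply mul_le_mul_of_nonneg_left _ hCH0
          exact add_le_add (mul_le_mul_of_nonneg_left h2 (by positivity))
            (mul_le_mul_of_nonneg_left h3 (by positivity))
        _ = H := hH.symm
    have h5 : ‖biotSavart (HelmholtzCentre.cutVorticity v y R) y‖ₑ ≤ G y := by
      calc ‖biotSavart (HelmholtzCentre.cutVorticity v y R) y‖ₑ
          ≤ ENNReal.ofReal (4 * Real.pi)⁻¹ *
              rieszPotential volume 1 (fun z => ‖HelmholtzCentre.cutVorticity v y R z‖ₑ) y :=
            enorm_biotSavart_le_rieszPotential _ _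
        _ ≤ ENNReal.ofReal a * rieszPotential volume 1 Φ y := by
            rw [ha_def]
            refine mul_le_mul' le_rfl (rieszPotential_mono volume 1 (fun z => ?_) y)
            rw [HelmholtzCentre.cutVorticity_apply, enorm_smul]
            by_cases hz : z ∈ ball x₀ (2 * R)
            · rw [hΦ, indicator_of_mem hz]
              calc ‖ballCutoff y (R / 3) z‖ₑ * ‖curl v z‖ₑ ≤ 1 * ‖curl v z‖ₑ := by
                    refine mul_le_mul' ?_ le_rfl
                    rw [Real.enorm_eq_ofReal_abs, abs_of_nonneg (ballCutoff_nonneg _ _ _)]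
                    exact ENNReal.ofReal_le_one.mpr (ballCutoff_le_one _ _ _)
                _ = ‖curl v z‖ₑ := one_mul _
            · have hfar : 3 * (R / 3) ≤ ‖z - y‖ := by
                rw [mem_ball, dist_eq_norm] at hy
                rw [mem_ball, dist_eq_norm, not_lt] at hz
                have : ‖z - x₀‖ ≤ ‖z - y‖ + ‖y - x₀‖ := norm_sub_le_norm_sub_add_norm_sub _ _ _
                linarith
              rw [ballCutoff_eq_zero (by positivity) hfar]
              simp
    calc ‖v y‖ₑ = ENNReal.ofReal ‖v y‖ := (ofReal_norm _).symm
      _ ≤ ENNReal.ofReal (‖biotSavart (HelmholtzCentre.cutVorticity v y R) y‖ + H) := by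
          refine ENNReal.ofReal_le_ofReal ?_
          have := norm_le_insert' (v y) (biotSavart (HelmholtzCentre.cutVorticity v y R) y)
          linarith
      _ = ‖biotSavart (HelmholtzCentre.cutVorticity v y R) y‖ₑ + ENNReal.ofReal H := by
          rw [ENNReal.ofReal_add (norm_nonneg _) hH0, ofReal_norm]
      _ ≤ G y + ENNReal.ofReal H := add_le_add h5 le_rfl
  -- Step B: integrate the cube of the majorant over the small ball
  have h4 : (2 : ℝ≥0∞) ^ ((3 : ℝ) - 1) = 4 := by
    rw [show (3 : ℝ) - 1 = ((2 : ℕ) : ℝ) by norm_num, ENNReal.rpow_natCast]; norm_num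
  have hB : ∫⁻ x in ball x₀ (2 * r), ‖v x‖ₑ ^ (3 : ℝ) ≤
      (4 * ∫⁻ x in ball x₀ (2 * r), G x ^ (3 : ℝ)) +
        4 * (ENNReal.ofReal H ^ (3 : ℝ) * volume (ball x₀ (2 * r))) := by
    calc ∫⁻ x in ball x₀ (2 * r), ‖v x‖ₑ ^ (3 : ℝ)
        ≤ ∫⁻ x in ball x₀ (2 * r), (4 * G x ^ (3 : ℝ) + 4 * ENNReal.ofReal H ^ (3 : ℝ)) := by
          refine setLIntegral_mono' measurableSet_ball fun x hx => ?_
          calc ‖v x‖ₑ ^ (3 : ℝ) ≤ (G x + ENNReal.ofReal H) ^ (3 : ℝ) :=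
                ENNReal.rpow_le_rpow (hA x hx) (by norm_num)
            _ ≤ 2 ^ ((3 : ℝ) - 1) * (G x ^ (3 : ℝ) + ENNReal.ofReal H ^ (3 : ℝ)) :=
                ENNReal.rpow_add_le_mul_rpow_add_rpow _ _ (by norm_num)
            _ = 4 * G x ^ (3 : ℝ) + 4 * ENNReal.ofReal H ^ (3 : ℝ) := by rw [h4, mul_add]
      _ = (4 * ∫⁻ x in ball x₀ (2 * r), G x ^ (3 : ℝ)) +
            4 * (ENNReal.ofReal H ^ (3 : ℝ) * volume (ball x₀ (2 * r))) := by
          rw [lintegral_add_left ((hGm.pow_const _).const_mul _), lintegral_const_mul' _ _ (by simp),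
            lintegral_const, Measure.restrict_apply_univ, mul_assoc]
  -- Step C: the Biot–Savart term by strong HLS and Cauchy–Schwarz
  have hΦ2 : ∫⁻ y, Φ y ^ (2 : ℝ) = ∫⁻ y in ball x₀ (2 * R), ‖curl v y‖ₑ ^ (2 : ℝ) := by
    rw [← lintegral_indicator measurableSet_ball]
    refine lintegral_congr fun y => ?_
    by_cases hy : y ∈ ball x₀ (2 * R)
    · simp [hΦ, indicator_of_mem hy]
    · simp [hΦ, indicator_of_notMem hy, ENNReal.zero_rpow_of_pos (by norm_num : (0 : ℝ) < 2)]
  have hΦ2' : ∫⁻ y in ball x₀ (2 * R), ‖curl v y‖ₑ ^ (2 : ℝ) = ENNReal.ofReal X := by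
    rw [hX, ofReal_integral_eq_lintegral_ofReal hint_ω2
      (Filter.Eventually.of_forall fun x => (by positivity : (0 : ℝ) ≤ ‖curl v x‖ ^ 2))]
    refine lintegral_congr fun y => ?_
    rw [← ofReal_norm, ENNReal.ofReal_rpow_of_nonneg (norm_nonneg _) (by norm_num), Real.rpow_two]
  have hE' : volume (ball x₀ (2 * r)) = ENNReal.ofReal (8 * v1 * r ^ (3 : ℝ)) := by
    rw [Measure.addHaar_ball_of_pos volume x₀ (by positivity : (0 : ℝ) < 2 * r),
      finrank_euclideanSpace_fin, hV1eq, ← ENNReal.ofReal_mul (by positivity)]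
    congr 1
    rw [show (3 : ℝ) = ((3 : ℕ) : ℝ) by norm_num, Real.rpow_natCast]; ring
  have hE'' : volume (ball x₀ (2 * r)) = ENNReal.ofReal (8 * v1 * r ^ 3) := by
    rw [Measure.addHaar_ball_of_pos volume x₀ (by positivity : (0 : ℝ) < 2 * r),
      finrank_euclideanSpace_fin, hV1eq, ← ENNReal.ofReal_mul (by positivity)]
    congr 1; ring
  have hG6 : ∫⁻ x in ball x₀ (2 * r), G x ^ (6 : ℝ) ≤
      ENNReal.ofReal (a ^ (6 : ℝ) * cS * X ^ (3 : ℝ)) := by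
    have hpt : ∀ x, G x ^ (6 : ℝ) = ENNReal.ofReal a ^ (6 : ℝ) * rieszPotential volume 1 Φ x ^ (6 : ℝ) :=
      fun x => ENNReal.mul_rpow_of_nonneg _ _ (by norm_num)
    calc ∫⁻ x in ball x₀ (2 * r), G x ^ (6 : ℝ) ≤ ∫⁻ x, G x ^ (6 : ℝ) := setLIntegral_le_lintegral _ _
      _ = ENNReal.ofReal a ^ (6 : ℝ) * ∫⁻ x, rieszPotential volume 1 Φ x ^ (6 : ℝ) := by
          rw [← lintegral_const_mul' _ _
            (ENNReal.rpow_ne_top_of_nonneg (by norm_num) ENNReal.ofReal_ne_top)]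
          exact lintegral_congr hpt
      _ ≤ ENNReal.ofReal a ^ (6 : ℝ) * (CS * (∫⁻ y, Φ y ^ (2 : ℝ)) ^ (3 : ℝ)) :=
          mul_le_mul' le_rfl (HS Φ hΦm.aemeasurable)
      _ = ENNReal.ofReal (a ^ (6 : ℝ) * cS * X ^ (3 : ℝ)) := by
          rw [hΦ2, hΦ2', ENNReal.ofReal_rpow_of_nonneg ha (by norm_num),
            ENNReal.ofReal_rpow_of_nonneg hX0 (by norm_num), hCSeq, ← ENNReal.ofReal_mul hcS,
            ← ENNReal.ofReal_mul (by positivity)]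
          congr 1; ring
  have hC : ∫⁻ x in ball x₀ (2 * r), G x ^ (3 : ℝ) ≤
      ENNReal.ofReal ((a ^ (6 : ℝ) * cS) ^ (1 / 2 : ℝ) * X ^ (3 / 2 : ℝ)) *
        ENNReal.ofReal ((8 * v1) ^ (1 / 2 : ℝ) * r ^ (3 / 2 : ℝ)) := by
    calc ∫⁻ x in ball x₀ (2 * r), G x ^ (3 : ℝ)
        ≤ (∫⁻ x in ball x₀ (2 * r), G x ^ (6 : ℝ)) ^ (1 / 2 : ℝ) *
            volume (ball x₀ (2 * r)) ^ (1 / 2 : ℝ) := setLIntegral_rpow_three_le hGm _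
      _ ≤ ENNReal.ofReal (a ^ (6 : ℝ) * cS * X ^ (3 : ℝ)) ^ (1 / 2 : ℝ) *
            ENNReal.ofReal (8 * v1 * r ^ (3 : ℝ)) ^ (1 / 2 : ℝ) :=
          mul_le_mul' (ENNReal.rpow_le_rpow hG6 (by norm_num))
            (ENNReal.rpow_le_rpow (le_of_eq hE') (by norm_num))
      _ = ENNReal.ofReal ((a ^ (6 : ℝ) * cS) ^ (1 / 2 : ℝ) * X ^ (3 / 2 : ℝ)) *
            ENNReal.ofReal ((8 * v1) ^ (1 / 2 : ℝ) * r ^ (3 / 2 : ℝ)) := by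
          rw [ENNReal.ofReal_rpow_of_nonneg (by positivity) (by norm_num),
            ENNReal.ofReal_rpow_of_nonneg (by positivity) (by norm_num),
            mul_rpow_three_sqrt (by positivity) hX0, mul_rpow_three_sqrt (by positivity) hr.le]
  -- Step D: assemble in `ofReal` form
  have hT1 : 4 * ∫⁻ x in ball x₀ (2 * r), G x ^ (3 : ℝ) ≤
      ENNReal.ofReal (K₁ * (r ^ (3 / 2 : ℝ) * X ^ (3 / 2 : ℝ))) := by
    calc 4 * ∫⁻ x in ball x₀ (2 * r), G x ^ (3 : ℝ)
        ≤ 4 * (ENNReal.ofReal ((a ^ (6 : ℝ) * cS) ^ (1 / 2 : ℝ) * X ^ (3 / 2 : ℝ)) *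
            ENNReal.ofReal ((8 * v1) ^ (1 / 2 : ℝ) * r ^ (3 / 2 : ℝ))) := mul_le_mul' le_rfl hC
      _ = ENNReal.ofReal (4 * (((a ^ (6 : ℝ) * cS) ^ (1 / 2 : ℝ) * X ^ (3 / 2 : ℝ)) *
            ((8 * v1) ^ (1 / 2 : ℝ) * r ^ (3 / 2 : ℝ)))) := by
          rw [← ENNReal.ofReal_mul (by positivity), show (4 : ℝ≥0∞) = ENNReal.ofReal 4 by simp,
            ← ENNReal.ofReal_mul (by norm_num)]
      _ = ENNReal.ofReal (K₁ * (r ^ (3 / 2 : ℝ) * X ^ (3 / 2 : ℝ))) := by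
          congr 1; rw [hK₁]; ring
  have hT2 : 4 * (ENNReal.ofReal H ^ (3 : ℝ) * volume (ball x₀ (2 * r))) ≤
      ENNReal.ofReal (K₂ * (r ^ 3 * Y ^ 3 + r ^ 3 * Z ^ 3)) := by
    have h3 : ENNReal.ofReal H ^ (3 : ℝ) = ENNReal.ofReal (H ^ 3) := by
      rw [ENNReal.ofReal_rpow_of_nonneg hH0 (by norm_num), show (3 : ℝ) = ((3 : ℕ) : ℝ) by norm_num,
        Real.rpow_natCast]
    rw [h3, hE'', ← ENNReal.ofReal_mul (by positivity), show (4 : ℝ≥0∞) = ENNReal.ofReal 4 by simp,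
      ← ENNReal.ofReal_mul (by norm_num)]
    refine ENNReal.ofReal_le_ofReal ?_
    have hYZ : (Y + Z) ^ 3 ≤ 4 * (Y ^ 3 + Z ^ 3) := by
      nlinarith [mul_nonneg (add_nonneg hY0 hZ0) (sq_nonneg (Y - Z)), hY0, hZ0]
    calc 4 * (H ^ 3 * (8 * v1 * r ^ 3)) = 32 * CH ^ 3 * v1 * r ^ 3 * (Y + Z) ^ 3 := by rw [hH]; ring
      _ ≤ 32 * CH ^ 3 * v1 * r ^ 3 * (4 * (Y ^ 3 + Z ^ 3)) :=
          mul_le_mul_of_nonneg_left hYZ (by positivity)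
      _ = K₂ * (r ^ 3 * Y ^ 3 + r ^ 3 * Z ^ 3) := by rw [hK₂]; ring
  calc ∫⁻ x in ball x₀ (2 * r), ‖v x‖ₑ ^ (3 : ℝ)
      ≤ (4 * ∫⁻ x in ball x₀ (2 * r), G x ^ (3 : ℝ)) +
          4 * (ENNReal.ofReal H ^ (3 : ℝ) * volume (ball x₀ (2 * r))) := hB
    _ ≤ ENNReal.ofReal (K₁ * (r ^ (3 / 2 : ℝ) * X ^ (3 / 2 : ℝ))) +
          ENNReal.ofReal (K₂ * (r ^ 3 * Y ^ 3 + r ^ 3 * Z ^ 3)) := add_le_add hT1 hT2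
    _ = ENNReal.ofReal (K₁ * (r ^ (3 / 2 : ℝ) * X ^ (3 / 2 : ℝ)) +
          K₂ * (r ^ 3 * Y ^ 3 + r ^ 3 * Z ^ 3)) :=
        (ENNReal.ofReal_add (by positivity) (by positivity)).symm
    _ ≤ ENNReal.ofReal ((K₁ + K₂ + 1) *
          (r ^ (3 / 2 : ℝ) * X ^ (3 / 2 : ℝ) + r ^ 3 * Y ^ 3 + r ^ 3 * Z ^ 3)) := by
        refine ENNReal.ofReal_le_ofReal ?_
        have h1 : 0 ≤ r ^ (3 / 2 : ℝ) * X ^ (3 / 2 : ℝ) := by positivity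
        have h2 : 0 ≤ r ^ 3 * Y ^ 3 + r ^ 3 * Z ^ 3 := by positivity
        nlinarith [mul_nonneg hK₂0 h1, mul_nonneg hK₁0 h2, h1, h2]

/-! **Q4 `QuietSliceSmallCube → LevelConcentration`** (registered stub `stub_levelConcentration_of_quietSlice`, size L —
the SAME plumbing as β).  Recipe, given `M`: `C_I := C(M)` from I1 (`ThinCascade.stub_uniformScaledEnergy`, PROVED; at the
vertex `t₁` via `frame_restrict`/`typeI_restrict`); `M̃ := (2C_I)^{1/2} ⊔ 1`; `γ, S := S(M̃) ≤ 1/4, β := S/18, C := C(M̃, β)`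
from `BarkerPrange2020_thm1_slab_bounds` (PROVED); `ϱ := ϱ(M)` with `C·8·θ³·c₁³C_I^{3/2}ϱ^{-3} ≤ γ³/3` at `θ = 2S^{-1/2}`
(`c₁`: `∫_{B_{2R}}‖u‖ ≤ c₁R^{3/2}(C_I·2R)^{1/2}` by Cauchy–Schwarz and I1(A) at radius `2R`), then `η := η(M)` with
`C(θ^{3/2}η^{3/2} + 8θ³c₂³η^{3/2}ϱ^{-3/2}) ≤ 2γ³/3`; `ρ := 2ϱ`.  For `D ≥ 8` put `a₁(M,D) := 1 + log(C S^{1/2}√D) ⊔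
½log(36/(8S)) ⊔ log(2ϱ)` (so that `r² ≤ t₁`, `(2R)² ≤ t₁` at every level `k ≥ 0`, and `C/r < e^{a}/√(Dσ)`).  Suppose, at a
level `k < n` (`s = s_{k+1}`, `σ = s/D`), some `t* ∈ [t₁ − 4σ, t₁ − σ]` had `∫_{B(x₀,ρ√σ)}‖ω(t*)‖² < ησ^{-1/2}`.  With
`r := ((t₁ − t*)/S)^{1/2} ∈ [√σ·S^{-1/2}, 2√σ·S^{-1/2}]` and `R := ϱ√σ ≥ 2r`: Q3 ⇒ `‖u(t*)‖_{L³(B(x₀,2r))} ≤ γ`; I1(A) at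
radius `r` (all centres, `t* ∈ [t₁ − r², t₁]` since `4σ ≤ r²`) ⇒ the rescaled datum `v₀(y) := r·u(t*, x₀ + ry)` has
`sup_{x₁}‖v₀‖_{L²(B(x₁,1))} ≤ M̃` and `‖v₀‖_{L³(B(0,2))} ≤ γ`; the rescaled classical solution on `[t*, t₁] = [t*, t* + Sr²]`
is a local energy solution with datum in `E²` (frame: `u(t*) ∈ H^m(ℝ³)` for all `m`; tree
`isLocalEnergySolutionOn_of_bounded_suitable`-type plumbing, Type-I gives boundedness on `[t*, t₁]`) ⇒ BP2020 Thm 1: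
`|u| ≤ C/r` a.e. on `(t* + βr², t₁) × B(x₀, r/3)`, hence by continuity `|u(t₁,x₀)| ≤ C/r ≤ C S^{1/2}/√σ = C S^{1/2}√D·e^{a(k+1)}/√t₁
< e^{a(k+2)}/√t₁ ≤ e^{a(n+1)}/√t₁ ≤ |u(t₁,x₀)|` — contradiction.  Hence `ConcBlock ρ η D u t₁ x₀ s_{k+1}` at every `k < n`. -/

/-- Q3 under its registered name (alias of `quietSliceSmallCube_holds`). -/
theorem stub_quietSliceSmallCube : QuietSliceSmallCube :=
  quietSliceSmallCube_holds


end

end Summit.NavierStokesRegularity.NavierStokesRegularity.Cruxes.TypeIQuantSubcubicExp.FlatChain
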